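import Summits.AtomisticToContinuum.FouriersLaw.Cruxes.BoundedResponseConverges.SketchIdeator2

/-!
# Triage r1-3, card `flat-without-current-liouville`: the typed First lemma has a VOID hypothesis

`Sketch2.ZeroCurrentDerivationsAreFlat` constrains `Λ.Λ` at the observable `j₀ = bondCurrentZ · 0`, which is
NOT a local test function (it is unbounded), while every field of `Sketch2.LinearGrowthDerivation` constrains
`Λ.Λ` only at local test functions (or asks a value to be `0`). Patching `Λ.Λ j₀ := 0` therefore preserves the
structure, so the typed lemma is equivalent to the statement with the zero-current hypothesis dropped:
"EVERY regular stationary linear-growth derivation is translation invariant" — which denies the tilted,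
current-carrying blow-up limit the card's own Transfer needs.
-/

noncomputable section

open MeasureTheory Filter Topology Set
open Literature.MathematicalPhysics.KineticTheory.HeatConduction
open Summit.AtomisticToContinuum.FouriersLaw.Cruxes.BoundedResponseConverges.Sketch2

namespace Summit.AtomisticToContinuum.FouriersLaw.Cruxes.BoundedResponseConverges.Triage3

/-- The typed lemma with its zero-current hypothesis DROPPED. -/
def AllDerivationsAreFlat : Prop :=
  ∀ ω₂ lam β : ℝ, 0 < ω₂ → 0 < lam → 0 < β → ∀ T : ℝ, 0 < T →
    ∀ μ : Measure ChainConfig, (pinnedChain ω₂ lam β 1).IsChainGibbsMeasure T μ →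
    ∀ Λ : LinearGrowthDerivation (pinnedChain ω₂ lam β 1) μ,
      ∀ f, IsLocalTestFunction f → Λ.Λ (f ∘ shift) = Λ.Λ f

/-- Local test functions are bounded. -/
theorem bounded_of_isLocalTestFunction {f : ChainConfig → ℝ} (hf : IsLocalTestFunction f) :
    ∃ M : ℝ, ∀ σ, |f σ| ≤ M := by
  obtain ⟨R, g, -, ⟨M, hM⟩, -, rfl⟩ := hf
  exact ⟨M, fun σ => hM _⟩

/-- The interaction force of `pinnedChain` at unit stretch: `V'(1) = 1 + β`. -/
theorem deriv_V_one (ω₂ lam β : ℝ) : deriv (pinnedChain ω₂ lam β 1).V 1 = 1 + β := by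
  have hV : (pinnedChain ω₂ lam β 1).V = fun r : ℝ => r ^ 2 / 2 + β * r ^ 4 / 4 := rfl
  rw [hV]
  have h : HasDerivAt (fun r : ℝ => r ^ 2 / 2 + β * r ^ 4 / 4)
      (((2 : ℕ) * (1:ℝ) ^ (2 - 1)) / 2 + β * ((4 : ℕ) * (1:ℝ) ^ (4 - 1)) / 4) 1 := by
    exact ((hasDerivAt_pow 2 (1:ℝ)).div_const 2).add
      (((hasDerivAt_pow 4 (1:ℝ)).const_mul β).div_const 4)
  rw [h.deriv]
  norm_num

/-- The bond current `j₀` of the infinite pinned chain is unbounded (`β ≥ 0`). -/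
theorem bondCurrentZ_large (ω₂ lam β : ℝ) (hβ : 0 ≤ β) (M : ℝ) :
    ∃ σ : ChainConfig, M < |(pinnedChain ω₂ lam β 1).bondCurrentZ σ 0| := by
  set t : ℝ := |M| + 1 with ht
  refine ⟨fun x => if x = 0 then (0, t) else (1, t), ?_⟩
  have h1 : ((1 : ℤ) = 0) = False := by simp
  simp only [OscillatorChain.bondCurrentZ, zero_add, if_true, h1, if_false, sub_zero, deriv_V_one]
  have htpos : 0 < t := by rw [ht]; positivity
  have : (t + t) / 2 * (1 + β) = t * (1 + β) := by ring
  rw [this, abs_neg, abs_of_nonneg (by positivity)]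
  calc M ≤ |M| := le_abs_self M
    _ < t := by rw [ht]; linarith
    _ ≤ t * (1 + β) := by nlinarith

/-- Hence no bounded function — in particular no local test function — equals `j₀`. -/
theorem ne_bondCurrentZ {ω₂ lam β : ℝ} (hβ : 0 ≤ β) {F : ChainConfig → ℝ}
    (hF : ∃ M : ℝ, ∀ σ, |F σ| ≤ M) :
    F ≠ fun σ => (pinnedChain ω₂ lam β 1).bondCurrentZ σ 0 := by
  rintro rfl
  obtain ⟨M, hM⟩ := hF
  obtain ⟨σ, hσ⟩ := bondCurrentZ_large ω₂ lam β hβ M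
  exact (lt_irrefl M) (hσ.trans_le (hM σ))

open Classical in
/-- Patching the junk value `Λ.Λ j₀ := 0` preserves every field of `LinearGrowthDerivation`. -/
def patch {ω₂ lam β : ℝ} (hβ : 0 ≤ β) {μ : Measure ChainConfig}
    (Λ : LinearGrowthDerivation (pinnedChain ω₂ lam β 1) μ) :
    LinearGrowthDerivation (pinnedChain ω₂ lam β 1) μ where
  Λ F := if F = (fun σ => (pinnedChain ω₂ lam β 1).bondCurrentZ σ 0) then 0 else Λ.Λ F
  add f g hf hg := by
    obtain ⟨Mf, hMf⟩ := bounded_of_isLocalTestFunction hf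
    obtain ⟨Mg, hMg⟩ := bounded_of_isLocalTestFunction hg
    have hfg : ∃ M : ℝ, ∀ σ, |(f + g) σ| ≤ M :=
      ⟨Mf + Mg, fun σ => (abs_add_le _ _).trans (add_le_add (hMf σ) (hMg σ))⟩
    rw [if_neg (ne_bondCurrentZ hβ hfg), if_neg (ne_bondCurrentZ hβ ⟨Mf, hMf⟩),
      if_neg (ne_bondCurrentZ hβ ⟨Mg, hMg⟩)]
    exact Λ.add f g hf hg
  smul c f hf := by
    obtain ⟨Mf, hMf⟩ := bounded_of_isLocalTestFunction hf
    have hcf : ∃ M : ℝ, ∀ σ, |(c • f) σ| ≤ M :=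
      ⟨|c| * Mf, fun σ => by
        rw [Pi.smul_apply, smul_eq_mul, abs_mul]
        exact mul_le_mul_of_nonneg_left (hMf σ) (abs_nonneg c)⟩
    rw [if_neg (ne_bondCurrentZ hβ hcf), if_neg (ne_bondCurrentZ hβ ⟨Mf, hMf⟩)]
    exact Λ.smul c f hf
  stationary f hf := by
    split_ifs with h
    · rfl
    · exact Λ.stationary f hf
  regular R := by
    obtain ⟨g, hg, hrep⟩ := Λ.regular R
    refine ⟨g, hg, fun f hf hbox => ?_⟩
    rw [if_neg (ne_bondCurrentZ hβ (bounded_of_isLocalTestFunction hf))]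
    exact hrep f hf hbox
  growth f hf := by
    obtain ⟨C, hC⟩ := Λ.growth f hf
    obtain ⟨Mf, hMf⟩ := bounded_of_isLocalTestFunction hf
    refine ⟨C, fun n => ?_⟩
    have h1 : ∃ M : ℝ, ∀ σ, |(f ∘ shift^[n]) σ| ≤ M := ⟨Mf, fun σ => hMf _⟩
    have h2 : ∃ M : ℝ, ∀ σ, |(f ∘ unshift^[n]) σ| ≤ M := ⟨Mf, fun σ => hMf _⟩
    rw [if_neg (ne_bondCurrentZ hβ h1), if_neg (ne_bondCurrentZ hβ h2)]
    exact hC n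

open Classical in
/-- **The zero-current hypothesis of the typed First lemma is void**: `ZeroCurrentDerivationsAreFlat`
already says that EVERY regular stationary linear-growth derivation is translation invariant. -/
theorem allFlat_of_zeroCurrentFlat (h : ZeroCurrentDerivationsAreFlat) : AllDerivationsAreFlat := by
  intro ω₂ lam β hω hl hβ T hT μ hμ Λ f hf
  have key := h ω₂ lam β hω hl hβ T hT μ hμ (patch hβ.le Λ) (by simp [patch]) f hf
  obtain ⟨Mf, hMf⟩ := bounded_of_isLocalTestFunction hf
  have h1 : ∃ M : ℝ, ∀ σ, |(f ∘ shift) σ| ≤ M := ⟨Mf, fun σ => hMf _⟩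
  have e1 : (patch hβ.le Λ).Λ (f ∘ shift) = Λ.Λ (f ∘ shift) := by
    show (if _ then _ else _) = _
    rw [if_neg (ne_bondCurrentZ hβ.le h1)]
  have e2 : (patch hβ.le Λ).Λ f = Λ.Λ f := by
    show (if _ then _ else _) = _
    rw [if_neg (ne_bondCurrentZ hβ.le ⟨Mf, hMf⟩)]
  rw [e1, e2] at key
  exact key

/-- Conversely (trivial direction), so the two statements are EQUIVALENT. -/
theorem zeroCurrentFlat_iff_allFlat : ZeroCurrentDerivationsAreFlat ↔ AllDerivationsAreFlat :=
  ⟨allFlat_of_zeroCurrentFlat, fun h ω₂ lam β hω hl hβ T hT μ hμ Λ _ f hf =>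
    h ω₂ lam β hω hl hβ T hT μ hμ Λ f hf⟩

end Summit.AtomisticToContinuum.FouriersLaw.Cruxes.BoundedResponseConverges.Triage3

end
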